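/-
Origin: expansion seat `planner-pub-hodgecm-pv14-g5-0`, handover #10 2026-08-18T10:51:34Z (v2) (`HOME/pub-hodgecm-pv14-g5/lean/Pv14g5/SchwartzChirp.lean`, md5 b770dbce, 361 lines);
landed by the gen-7 packager in gate run 28 as `HodgeCM/Automorphic/SchwartzChirp.lean` (import ^import Pv14g5\.→import HodgeCM.Automorphic. ×1).
-/
/-
Origin: HOME/pub-hodgecm-pv14-g5/lean/Pv14g5/SchwartzChirp.lean — session planner-pub-hodgecm-pv14-g5-0
(unit pub-hodgecm-pv14-g5, DAG-node prover #14 gen 5).  Intended final place: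
`HodgeCM/Automorphic/SchwartzChirp.lean` (namespace `HodgeCM.SchwartzWeil`).
PACKAGER: rewrite `import Pv14g5.WeilThetaModelHeisenberg` to `import HodgeCM.Automorphic.WeilThetaModelHeisenberg`
(this seat's #5).
Asserts nothing (no `axiom`, no new constants).
-/
import Summits.HodgeConjecture.HodgeCM.Automorphic.WeilThetaModelHeisenberg_2
import Mathlib.Analysis.Fourier.FourierTransformDeriv

/-!
# The chirp operators `T_c Φ = 𝐞(c‖x‖²) Φ` on Schwartz space and the unipotent automorphisms of `Heis V`

The third generator of Weil's `Ps(X)` at the real place — the symmetric ("upper unipotent") element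
`t(c) : Φ ↦ 𝐞(c‖x‖²) Φ` of `Sp`/`Mp` acting in the Schrödinger model [We64 n° 7, n° 13 `t(f)`] — as KERNEL
mathematics on `𝓢(V, ℂ)`:

* `hasTemperateGrowth_fourierChar` — `s ↦ 𝐞 s : ℝ → ℂ` has temperate growth (all derivatives bounded by `(2π)ⁿ`;
  `iteratedDeriv_fourierChar`); hence `hasTemperateGrowth_chirp` for `x ↦ 𝐞(c‖x‖²)` and the continuous operators
  **`chirpCLM V c : 𝓢(V, ℂ) →L[ℂ] 𝓢(V, ℂ)`** (Mathlib `SchwartzMap.smulLeftCLM`), a one-parameter group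
  (`chirpCLM_zero`, `chirpCLM_add`), pointwise isometric (`norm_chirpCLM_apply`), `chirpEquiv`;
* **`Heis.unip t`** — the automorphism `(a, b, u) ↦ (a, b + t a, u 𝐞(-t‖a‖²/2))` of the Heisenberg group
  (`MulAut`, one-parameter: `unip_add`; continuous), and the INTERTWINING law
  **`chirpCLM_repCLM : T_{mt/2} ∘ ρ_m(h) = ρ_m(n_t h) ∘ T_{mt/2}`**;
* theta: `tsum_chirpCLM` (`Σ_{v ∈ L} (T_c Φ)(v) = Σ_{v ∈ L} Φ(v)` when `c‖v‖² ∈ ℤ` on `L`), hence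
  `thetaH_chirpCLM_one`; for an INTEGRAL lattice (`L ≤ L*`) and `c = k m` (`k : ℤ`): `thetaH_chirpCLM_one_of_le`,
  and `unip (2k)` preserves `arith` (`unip_mem_arith`).

Joint continuity of `(c, Φ) ↦ T_c Φ` (needed to adjoin the whole one-parameter group with its real topology) is
NOT proved here; downstream the chirp is adjoined as a discrete generator.
-/

set_option autoImplicit false

noncomputable section

open MeasureTheory
open scoped RealInnerProductSpace FourierTransform SchwartzMap

namespace HodgeCM
namespace SchwartzWeil

/-! ## 1. `s ↦ 𝐞 s : ℝ → ℂ` has temperate growth -/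

/-- (Ported verbatim from the HodgeCMPerL package; no docstring in the source.) -/
theorem iteratedDeriv_fourierChar (n : ℕ) :
    iteratedDeriv n (fun s : ℝ => (𝐞 s : ℂ)) = fun s => (2 * Real.pi * Complex.I) ^ n * (𝐞 s : ℂ) := by
  induction n with
  | zero => funext s; rw [iteratedDeriv_zero, pow_zero, one_mul]
  | succ n ih =>
    rw [iteratedDeriv_succ, ih]
    funext s
    rw [((Real.hasDerivAt_fourierChar s).const_mul ((2 * Real.pi * Complex.I) ^ n)).deriv, pow_succ]
    ring

/-- (Ported verbatim from the HodgeCMPerL package; no docstring in the source.) -/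
theorem contDiff_fourierChar : ContDiff ℝ (⊤ : ℕ∞) (fun s : ℝ => (𝐞 s : ℂ)) := by
  have h : (fun s : ℝ => (𝐞 s : ℂ)) = fun s : ℝ => Complex.exp (2 * Real.pi * Complex.I * (s : ℂ)) := by
    funext s
    rw [Real.fourierChar_apply]
    push_cast
    ring_nf
  rw [h]
  exact (contDiff_const.mul Complex.ofRealCLM.contDiff).cexp

/-- (Ported verbatim from the HodgeCMPerL package; no docstring in the source.) -/
theorem norm_two_pi_I : ‖(2 * Real.pi * Complex.I : ℂ)‖ = 2 * Real.pi := by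
  simp [abs_of_pos Real.pi_pos]

/-- **`s ↦ 𝐞 s` has temperate growth**: `‖(d/ds)ⁿ 𝐞 s‖ = (2π)ⁿ`. -/
theorem hasTemperateGrowth_fourierChar : Function.HasTemperateGrowth (fun s : ℝ => (𝐞 s : ℂ)) := by
  refine ⟨contDiff_fourierChar, fun n => ⟨0, (2 * Real.pi) ^ n, fun s => ?_⟩⟩
  rw [norm_iteratedFDeriv_eq_norm_iteratedDeriv, iteratedDeriv_fourierChar, norm_mul, norm_pow, Circle.norm_coe,
    mul_one, pow_zero, mul_one, norm_two_pi_I]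

/-! ## 2. The chirp operators -/

section Chirp

variable (V : Type*) [NormedAddCommGroup V] [InnerProductSpace ℝ V]

/-- The chirp `x ↦ 𝐞(c‖x‖²)`. -/
def chirp (c : ℝ) : V → ℂ := fun x => (𝐞 (c * ‖x‖ ^ 2) : ℂ)

omit [InnerProductSpace ℝ V] in
/-- (Ported verbatim from the HodgeCMPerL package; no docstring in the source.) -/
@[simp] theorem chirp_apply (c : ℝ) (x : V) : chirp V c x = (𝐞 (c * ‖x‖ ^ 2) : ℂ) := rfl

/-- **The chirp has temperate growth.** -/
theorem hasTemperateGrowth_chirp (c : ℝ) : (chirp V c).HasTemperateGrowth :=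
  hasTemperateGrowth_fourierChar.comp (f := fun x : V => c * ‖x‖ ^ 2) (by fun_prop)

/-- **The chirp operator** `T_c Φ = 𝐞(c‖·‖²) Φ` as a continuous `ℂ`-linear operator of `𝓢(V, ℂ)`. -/
def chirpCLM (c : ℝ) : 𝓢(V, ℂ) →L[ℂ] 𝓢(V, ℂ) :=
  SchwartzMap.smulLeftCLM ℂ (chirp V c)

/-- (Ported verbatim from the HodgeCMPerL package; no docstring in the source.) -/
@[simp] theorem chirpCLM_apply (c : ℝ) (Φ : 𝓢(V, ℂ)) (x : V) :
    chirpCLM V c Φ x = (𝐞 (c * ‖x‖ ^ 2) : ℂ) * Φ x := by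
  rw [chirpCLM, SchwartzMap.smulLeftCLM_apply_apply (hasTemperateGrowth_chirp V c), smul_eq_mul, chirp_apply]

/-- (Ported verbatim from the HodgeCMPerL package; no docstring in the source.) -/
theorem coe_chirpCLM (c : ℝ) (Φ : 𝓢(V, ℂ)) : ⇑(chirpCLM V c Φ) = fun x => (𝐞 (c * ‖x‖ ^ 2) : ℂ) * Φ x :=
  funext (chirpCLM_apply V c Φ)

/-- (Ported verbatim from the HodgeCMPerL package; no docstring in the source.) -/
theorem norm_chirpCLM_apply (c : ℝ) (Φ : 𝓢(V, ℂ)) (x : V) : ‖chirpCLM V c Φ x‖ = ‖Φ x‖ := by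
  rw [chirpCLM_apply, norm_mul, Circle.norm_coe, one_mul]

/-- (Ported verbatim from the HodgeCMPerL package; no docstring in the source.) -/
theorem chirpCLM_zero : chirpCLM V 0 = ContinuousLinearMap.id ℂ 𝓢(V, ℂ) := by
  ext Φ x
  rw [chirpCLM_apply, zero_mul, AddChar.map_zero_eq_one, Circle.coe_one, one_mul, ContinuousLinearMap.id_apply]

/-- One-parameter group law `T_{c + c'} = T_c ∘ T_{c'}`. -/
theorem chirpCLM_add (c c' : ℝ) : chirpCLM V (c + c') = (chirpCLM V c).comp (chirpCLM V c') := by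
  ext Φ x
  simp only [chirpCLM_apply, ContinuousLinearMap.comp_apply, add_mul, AddChar.map_add_eq_mul, Circle.coe_mul,
    mul_assoc]

/-- (Ported verbatim from the HodgeCMPerL package; no docstring in the source.) -/
theorem chirpCLM_comm (c c' : ℝ) : (chirpCLM V c).comp (chirpCLM V c') = (chirpCLM V c').comp (chirpCLM V c) := by
  rw [← chirpCLM_add, add_comm, chirpCLM_add]

/-- (Ported verbatim from the HodgeCMPerL package; no docstring in the source.) -/
theorem chirpCLM_neg_comp (c : ℝ) : (chirpCLM V (-c)).comp (chirpCLM V c) = ContinuousLinearMap.id ℂ 𝓢(V, ℂ) := by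
  rw [← chirpCLM_add, neg_add_cancel, chirpCLM_zero]

/-- (Ported verbatim from the HodgeCMPerL package; no docstring in the source.) -/
theorem chirpCLM_comp_neg (c : ℝ) : (chirpCLM V c).comp (chirpCLM V (-c)) = ContinuousLinearMap.id ℂ 𝓢(V, ℂ) := by
  rw [← chirpCLM_add, add_neg_cancel, chirpCLM_zero]

/-- (Ported verbatim from the HodgeCMPerL package; no docstring in the source.) -/
theorem chirpCLM_neg_apply_apply (c : ℝ) (Φ : 𝓢(V, ℂ)) : chirpCLM V (-c) (chirpCLM V c Φ) = Φ := by
  rw [← ContinuousLinearMap.comp_apply, chirpCLM_neg_comp, ContinuousLinearMap.id_apply]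

/-- (Ported verbatim from the HodgeCMPerL package; no docstring in the source.) -/
theorem chirpCLM_apply_neg_apply (c : ℝ) (Φ : 𝓢(V, ℂ)) : chirpCLM V c (chirpCLM V (-c) Φ) = Φ := by
  rw [← ContinuousLinearMap.comp_apply, chirpCLM_comp_neg, ContinuousLinearMap.id_apply]

/-- `T_c` as a continuous linear automorphism of `𝓢(V, ℂ)` with inverse `T_{-c}`. -/
def chirpEquiv (c : ℝ) : 𝓢(V, ℂ) ≃L[ℂ] 𝓢(V, ℂ) :=
  ContinuousLinearEquiv.equivOfInverse (chirpCLM V c) (chirpCLM V (-c)) (chirpCLM_neg_apply_apply V c)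
    (chirpCLM_apply_neg_apply V c)

/-- (Ported verbatim from the HodgeCMPerL package; no docstring in the source.) -/
@[simp] theorem chirpEquiv_apply (c : ℝ) (Φ : 𝓢(V, ℂ)) : chirpEquiv V c Φ = chirpCLM V c Φ := rfl

/-- (Ported verbatim from the HodgeCMPerL package; no docstring in the source.) -/
@[simp] theorem chirpEquiv_symm_apply (c : ℝ) (Φ : 𝓢(V, ℂ)) : (chirpEquiv V c).symm Φ = chirpCLM V (-c) Φ := rfl

/-- `Σ_{v ∈ L} (T_c Φ)(v) = Σ_{v ∈ L} Φ(v)` as soon as `c‖v‖² ∈ ℤ` on `L`. -/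
theorem tsum_chirpCLM (L : Submodule ℤ V) (c : ℝ) (hc : ∀ v ∈ L, ∃ k : ℤ, (k : ℝ) = c * ‖v‖ ^ 2)
    (Φ : 𝓢(V, ℂ)) : ∑' v : L, chirpCLM V c Φ (v : V) = ∑' v : L, Φ (v : V) := by
  refine tsum_congr fun v => ?_
  obtain ⟨k, hk⟩ := hc v v.2
  rw [chirpCLM_apply, ← hk, PoissonSummation.fourierChar_intCast, Circle.coe_one, one_mul]

/-- For an INTEGRAL lattice (`L ≤ L*`) `‖v‖² ∈ ℤ` on `L`, so every `c = k ∈ ℤ` qualifies. -/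
theorem exists_int_eq_norm_sq_of_le_dualLattice (L : Submodule ℤ V) (hL : L ≤ PoissonSummation.dualLattice L)
    {v : V} (hv : v ∈ L) : ∃ k : ℤ, (k : ℝ) = ‖v‖ ^ 2 := by
  obtain ⟨k, hk⟩ := PoissonSummation.mem_dualLattice.mp (hL hv) v hv
  exact ⟨k, by rw [hk, real_inner_self_eq_norm_sq]⟩

/-- (Ported verbatim from the HodgeCMPerL package; no docstring in the source.) -/
theorem exists_int_eq_int_mul_norm_sq_of_le_dualLattice (L : Submodule ℤ V)
    (hL : L ≤ PoissonSummation.dualLattice L) (k : ℤ) :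
    ∀ v ∈ L, ∃ n : ℤ, (n : ℝ) = (k : ℝ) * ‖v‖ ^ 2 := by
  intro v hv
  obtain ⟨n, hn⟩ := exists_int_eq_norm_sq_of_le_dualLattice V L hL hv
  exact ⟨k * n, by rw [Int.cast_mul, hn]⟩

/-- (Ported verbatim from the HodgeCMPerL package; no docstring in the source.) -/
theorem tsum_chirpCLM_of_le_dualLattice (L : Submodule ℤ V) (hL : L ≤ PoissonSummation.dualLattice L) (k : ℤ)
    (Φ : 𝓢(V, ℂ)) : ∑' v : L, chirpCLM V k Φ (v : V) = ∑' v : L, Φ (v : V) :=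
  tsum_chirpCLM V L k (exists_int_eq_int_mul_norm_sq_of_le_dualLattice V L hL k) Φ

end Chirp

/-! ## 3. The unipotent automorphisms `n_t` of the Heisenberg group -/

namespace Heis

variable {V : Type*} [NormedAddCommGroup V] [InnerProductSpace ℝ V]

/-- The map underlying `n_t`: `(a, b, u) ↦ (a, b + t a, u 𝐞(-t‖a‖²/2))`. -/
def unipFun (t : ℝ) (h : Heis V) : Heis V :=
  ⟨h.a, h.b + t • h.a, h.u * 𝐞 (-(t * ‖h.a‖ ^ 2 / 2))⟩

/-- (Ported verbatim from the HodgeCMPerL package; no docstring in the source.) -/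
@[simp] theorem unipFun_a (t : ℝ) (h : Heis V) : (unipFun t h).a = h.a := rfl
/-- (Ported verbatim from the HodgeCMPerL package; no docstring in the source.) -/
@[simp] theorem unipFun_b (t : ℝ) (h : Heis V) : (unipFun t h).b = h.b + t • h.a := rfl
/-- (Ported verbatim from the HodgeCMPerL package; no docstring in the source.) -/
@[simp] theorem unipFun_u (t : ℝ) (h : Heis V) : (unipFun t h).u = h.u * 𝐞 (-(t * ‖h.a‖ ^ 2 / 2)) := rfl

/-- (Ported verbatim from the HodgeCMPerL package; no docstring in the source.) -/
theorem unipFun_add (s t : ℝ) (h : Heis V) : unipFun (s + t) h = unipFun s (unipFun t h) := by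
  ext
  · rfl
  · simp only [unipFun_b, unipFun_a, add_smul]
    abel
  · simp only [unipFun_u, unipFun_a, mul_assoc, ← AddChar.map_add_eq_mul]
    ring_nf

/-- (Ported verbatim from the HodgeCMPerL package; no docstring in the source.) -/
theorem unipFun_zero (h : Heis V) : unipFun 0 h = h := by
  ext
  · rfl
  · simp only [unipFun_b, zero_smul, add_zero]
  · simp only [unipFun_u, zero_mul, zero_div, neg_zero, AddChar.map_zero_eq_one, mul_one]

/-- (Ported verbatim from the HodgeCMPerL package; no docstring in the source.) -/
theorem unipFun_mul (t : ℝ) (h h' : Heis V) : unipFun t (h * h') = unipFun t h * unipFun t h' := by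
  ext
  · simp only [unipFun_a, mul_a]
  · simp only [unipFun_b, mul_a, mul_b, smul_add]
    abel
  · simp only [unipFun_u, mul_u, mul_a, unipFun_a, unipFun_b, inner_add_right, real_inner_smul_right]
    rw [mul_assoc (h.u * h'.u), ← AddChar.map_add_eq_mul, mul_mul_mul_comm, mul_assoc (h.u * h'.u),
      ← AddChar.map_add_eq_mul, ← AddChar.map_add_eq_mul, norm_add_sq_real]
    ring_nf

/-- **The unipotent automorphism** `n_t (a, b, u) = (a, b + t a, u 𝐞(-t‖a‖²/2))` of `Heis V` — conjugation by the
symplectic shear `(x, y) ↦ (x, y + t x)` lifted to the Heisenberg group. -/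
def unip (t : ℝ) : MulAut (Heis V) where
  toFun := unipFun t
  invFun := unipFun (-t)
  left_inv h := by rw [← unipFun_add, neg_add_cancel, unipFun_zero]
  right_inv h := by rw [← unipFun_add, add_neg_cancel, unipFun_zero]
  map_mul' := unipFun_mul t

/-- (Ported verbatim from the HodgeCMPerL package; no docstring in the source.) -/
@[simp] theorem unip_apply (t : ℝ) (h : Heis V) : unip t h = unipFun t h := rfl
/-- (Ported verbatim from the HodgeCMPerL package; no docstring in the source.) -/
@[simp] theorem unip_symm_apply (t : ℝ) (h : Heis V) : (unip t).symm h = unipFun (-t) h := rfl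

/-- (Ported verbatim from the HodgeCMPerL package; no docstring in the source.) -/
theorem unip_a (t : ℝ) (h : Heis V) : (unip t h).a = h.a := rfl
/-- (Ported verbatim from the HodgeCMPerL package; no docstring in the source.) -/
theorem unip_b (t : ℝ) (h : Heis V) : (unip t h).b = h.b + t • h.a := rfl
/-- (Ported verbatim from the HodgeCMPerL package; no docstring in the source.) -/
theorem unip_u (t : ℝ) (h : Heis V) : (unip t h).u = h.u * 𝐞 (-(t * ‖h.a‖ ^ 2 / 2)) := rfl

/-- (Ported verbatim from the HodgeCMPerL package; no docstring in the source.) -/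
theorem unip_zero : (unip 0 : MulAut (Heis V)) = 1 := by
  ext h : 1
  rw [unip_apply, unipFun_zero, MulAut.one_apply]

/-- One-parameter group law `n_{s + t} = n_s n_t`. -/
theorem unip_add (s t : ℝ) : (unip (s + t) : MulAut (Heis V)) = unip s * unip t := by
  ext h : 1
  rw [MulAut.mul_apply, unip_apply, unip_apply, unip_apply, unipFun_add]

/-- (Ported verbatim from the HodgeCMPerL package; no docstring in the source.) -/
theorem unip_neg (t : ℝ) : (unip (-t) : MulAut (Heis V)) = (unip t)⁻¹ := by
  rw [eq_inv_iff_mul_eq_one, ← unip_add, neg_add_cancel, unip_zero]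

/-- `t ↦ n_t` as a homomorphism `ℝ → Aut(Heis V)`. -/
def unipHom : Multiplicative ℝ →* MulAut (Heis V) where
  toFun t := unip t.toAdd
  map_one' := unip_zero
  map_mul' s t := unip_add s.toAdd t.toAdd

/-- (Ported verbatim from the HodgeCMPerL package; no docstring in the source.) -/
@[simp] theorem unipHom_apply (t : Multiplicative ℝ) : (unipHom t : MulAut (Heis V)) = unip t.toAdd := rfl

/-- (Ported verbatim from the HodgeCMPerL package; no docstring in the source.) -/
theorem unip_center (t : ℝ) (z : Circle) : unip t (center z : Heis V) = center z := by
  ext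
  · rfl
  · simp only [unip_apply, unipFun_b, center_a, smul_zero, add_zero, center_b]
  · simp only [unip_apply, unipFun_u, center_u, center_a, norm_zero, zero_pow two_ne_zero, mul_zero, zero_div,
      neg_zero, AddChar.map_zero_eq_one, mul_one]

/-- (Ported verbatim from the HodgeCMPerL package; no docstring in the source.) -/
theorem continuous_unipFun (t : ℝ) : Continuous (unipFun t : Heis V → Heis V) :=
  continuous_mk continuous_a (continuous_b.add (continuous_a.const_smul t))
    (continuous_u.mul (Real.continuous_fourierChar.comp ((continuous_a.norm.pow 2).const_mul t
      |>.div_const 2).neg))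

/-- (Ported verbatim from the HodgeCMPerL package; no docstring in the source.) -/
theorem continuous_unip (t : ℝ) : Continuous (unip t : Heis V → Heis V) :=
  continuous_unipFun t

end Heis

/-! ## 4. The intertwining law `T ∘ ρ(h) = ρ(n_t h) ∘ T` -/

section Intertwine

variable (V : Type) [NormedAddCommGroup V] [InnerProductSpace ℝ V] [FiniteDimensional ℝ V] [MeasurableSpace V]
  [BorelSpace V] (m : ℤ)

omit [FiniteDimensional ℝ V] [MeasurableSpace V] [BorelSpace V] in
/-- The phase bookkeeping: `c‖x‖² + m⟪b, x⟫ = m·(-t‖a‖²/2) + m⟪b + t a, x⟫ + c‖x - a‖²` for `c = m t / 2`. -/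
theorem chirp_phase (t : ℝ) (a b x : V) :
    m * t / 2 * ‖x‖ ^ 2 + ⟪(m : ℝ) • b, x⟫ =
      m • (-(t * ‖a‖ ^ 2 / 2)) + (⟪(m : ℝ) • (b + t • a), x⟫ + m * t / 2 * ‖x - a‖ ^ 2) := by
  rw [smul_add, inner_add_left, smul_comm, real_inner_smul_left, real_inner_smul_left, real_inner_smul_left,
    norm_sub_sq_real, zsmul_eq_mul, real_inner_comm a x]
  ring

/-- **Intertwining** `T_{mt/2} (ρ_m(h) Φ) = ρ_m(n_t h) (T_{mt/2} Φ)`: conjugation by the chirp acts on the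
Schrödinger representation through the unipotent automorphism `n_t` of the Heisenberg group. -/
theorem chirpCLM_repCLM (t : ℝ) (h : Heis V) (Φ : 𝓢(V, ℂ)) :
    chirpCLM V (m * t / 2) (repCLM V m h Φ) = repCLM V m (Heis.unip t h) (chirpCLM V (m * t / 2) Φ) := by
  ext x
  simp only [chirpCLM_apply, repCLM_apply, Heis.unip_apply, Heis.unipFun_a, Heis.unipFun_b, Heis.unipFun_u,
    Circle.coe_mul, mul_zpow, ← Circle.coe_zpow, ← AddChar.map_zsmul_eq_zpow]
  calc (𝐞 (m * t / 2 * ‖x‖ ^ 2) : ℂ) * ((h.u : ℂ) ^ m * ((𝐞 ⟪(m : ℝ) • h.b, x⟫ : ℂ) * Φ (x - h.a)))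
      = (h.u : ℂ) ^ m * (𝐞 (m * t / 2 * ‖x‖ ^ 2 + ⟪(m : ℝ) • h.b, x⟫) : ℂ) * Φ (x - h.a) := by
        rw [AddChar.map_add_eq_mul, Circle.coe_mul]; ring
    _ = (h.u : ℂ) ^ m * (𝐞 (m • (-(t * ‖h.a‖ ^ 2 / 2)) + (⟪(m : ℝ) • (h.b + t • h.a), x⟫
          + m * t / 2 * ‖x - h.a‖ ^ 2)) : ℂ) * Φ (x - h.a) := by rw [chirp_phase]
    _ = (h.u : ℂ) ^ m * ((𝐞 (m • (-(t * ‖h.a‖ ^ 2 / 2))) : Circle) : ℂ) *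
          ((𝐞 ⟪(m : ℝ) • (h.b + t • h.a), x⟫ : ℂ) * ((𝐞 (m * t / 2 * ‖x - h.a‖ ^ 2) : ℂ) * Φ (x - h.a))) := by
        rw [AddChar.map_add_eq_mul, AddChar.map_add_eq_mul, Circle.coe_mul, Circle.coe_mul]; ring

/-- The same law as an identity of operators. -/
theorem chirpCLM_comp_repCLM (t : ℝ) (h : Heis V) :
    (chirpCLM V (m * t / 2)).comp (repCLM V m h) = (repCLM V m (Heis.unip t h)).comp (chirpCLM V (m * t / 2)) := by
  ext Φ : 1
  exact chirpCLM_repCLM V m t h Φ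

/-- Conjugation form: `T ρ(h) T⁻¹ = ρ(n_t h)`. -/
theorem chirpCLM_repCLM_chirpCLM_neg (t : ℝ) (h : Heis V) (Φ : 𝓢(V, ℂ)) :
    chirpCLM V (m * t / 2) (repCLM V m h (chirpCLM V (-(m * t / 2)) Φ)) = repCLM V m (Heis.unip t h) Φ := by
  rw [chirpCLM_repCLM, chirpCLM_apply_neg_apply]

/-- The intertwining relation with the exponent given as an equation `c = m t / 2` (so that integral specialisations
such as `c = m`, `t = 2` rewrite without casts). -/
theorem chirpCLM_repCLM_of_eq {c t : ℝ} (hct : c = m * t / 2) (h : Heis V) (Φ : 𝓢(V, ℂ)) :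
    chirpCLM V c (repCLM V m h Φ) = repCLM V m (Heis.unip t h) (chirpCLM V c Φ) := by
  subst hct
  exact chirpCLM_repCLM V m t h Φ

/-- (Ported verbatim from the HodgeCMPerL package; no docstring in the source.) -/
theorem chirpCLM_repCLM_chirpCLM_neg_of_eq {c t : ℝ} (hct : c = m * t / 2) (h : Heis V) (Φ : 𝓢(V, ℂ)) :
    chirpCLM V c (repCLM V m h (chirpCLM V (-c) Φ)) = repCLM V m (Heis.unip t h) Φ := by
  subst hct
  exact chirpCLM_repCLM_chirpCLM_neg V m t h Φ

/-- **The basic unipotent generator**: `T_m ∘ ρ_m(h) ∘ T_{-m} = ρ_m(u_2 h)` (`c = m`, `t = 2`). -/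
theorem chirpCLM_int_repCLM_chirpCLM_neg (h : Heis V) (Φ : 𝓢(V, ℂ)) :
    chirpCLM V m (repCLM V m h (chirpCLM V (-(m : ℝ)) Φ)) = repCLM V m (Heis.unip 2 h) Φ :=
  chirpCLM_repCLM_chirpCLM_neg_of_eq V m (by ring) h Φ

end Intertwine

/-! ## 5. Theta: invariance under the arithmetic chirps; `n_{2k}` preserves `arith` -/

section Theta

variable (V : Type) [NormedAddCommGroup V] [InnerProductSpace ℝ V] [FiniteDimensional ℝ V] [MeasurableSpace V]
  [BorelSpace V] (L : Submodule ℤ V) (m : ℤ)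

/-- `Θ_{T_c Φ}(1) = Θ_Φ(1)` when `c‖v‖² ∈ ℤ` on `L`. -/
theorem thetaH_chirpCLM_one (c : ℝ) (hc : ∀ v ∈ L, ∃ k : ℤ, (k : ℝ) = c * ‖v‖ ^ 2) (Φ : 𝓢(V, ℂ)) :
    thetaH V L m (chirpCLM V c Φ) 1 = thetaH V L m Φ 1 := by
  rw [thetaH_one, thetaH_one, tsum_chirpCLM V L c hc Φ]

/-- **`Θ_{T_k Φ}(1) = Θ_Φ(1)` for an integral lattice and `k ∈ ℤ`.** -/
theorem thetaH_chirpCLM_one_of_le (hL : L ≤ PoissonSummation.dualLattice L) (k : ℤ) (Φ : 𝓢(V, ℂ)) :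
    thetaH V L m (chirpCLM V k Φ) 1 = thetaH V L m Φ 1 :=
  thetaH_chirpCLM_one V L m k (exists_int_eq_int_mul_norm_sq_of_le_dualLattice V L hL k) Φ

/-- `Θ_{T_{mt/2} Φ}(h) = Θ_{T_{mt/2} (ρ(n_{-t} h) Φ)}(1)`: the general value reduces to the base point through the
intertwining law. -/
theorem thetaH_chirpCLM (t : ℝ) (Φ : 𝓢(V, ℂ)) (h : Heis V) :
    thetaH V L m (chirpCLM V (m * t / 2) Φ) h =
      thetaH V L m (chirpCLM V (m * t / 2) (repCLM V m (Heis.unip (-t) h) Φ)) 1 := by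
  rw [chirpCLM_repCLM, ← MulAut.mul_apply, ← Heis.unip_add, add_neg_cancel, Heis.unip_zero, MulAut.one_apply,
    thetaH_repCLM, one_mul]

omit [FiniteDimensional ℝ V] [MeasurableSpace V] [BorelSpace V] in
/-- **`n_{2k}` preserves `arith`** for an integral lattice (`k : ℤ`). -/
theorem unip_mem_arith (hL : L ≤ PoissonSummation.dualLattice L) (k : ℤ) {h : Heis V} (hh : h ∈ arith V L m) :
    Heis.unip (2 * k) h ∈ arith V L m := by
  obtain ⟨ha, hb, hu⟩ := hh
  obtain ⟨n, hn⟩ := exists_int_eq_norm_sq_of_le_dualLattice V L hL ha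
  refine ⟨ha, ?_, ?_⟩
  · rw [Heis.unip_apply, Heis.unipFun_b, smul_add, smul_smul, show (m : ℝ) * (2 * k) = ((m * (2 * k) : ℤ) : ℝ) by
      push_cast; ring, Int.cast_smul_eq_zsmul ℝ (m * (2 * k)) h.a]
    exact (PoissonSummation.dualLattice L).add_mem hb ((PoissonSummation.dualLattice L).smul_mem _ (hL ha))
  · rw [Heis.unip_apply, Heis.unipFun_u, mul_zpow, hu, one_mul, ← AddChar.map_zsmul_eq_zpow, ← hn,
      show m • (-(2 * (k : ℝ) * n / 2)) = ((-(m * k * n) : ℤ) : ℝ) by rw [zsmul_eq_mul]; push_cast; ring,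
      PoissonSummation.fourierChar_intCast]

end Theta

end SchwartzWeil
end HodgeCM

end
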